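/-
Copyright (c) 2026 the pub-hodgecm-mathlib formalisation cell (harness21).  Prover seat hodgecm-mathlib-K2E1-p12 (g0), Track B ∕ K2-LIT (build stream 29),
h413 = `stmt-HodgeConjecture-24833`, line `K2_E1_TraceFormulaBeta`, 5Res campaign «BL-2(χ,τ) ∘ MS-2(χ,τ) ∘ ARCH-UNITARITY ∘ R8₂» (K2E4-p23 (g2)'s map of record, dealer
K2E1-plan (g6) ruling (58)), deal (63) 2026-09-04T10:22:11Z: (d) ARCH-UNITARITY FILE 1 — THE CASIMIR SCALAR OF A UNITARIZABLE `(𝔤, K)`-MODULE IS REAL.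
-/
import Literature.RepresentationTheory.BorelWallach2000.U11UnitaryDual     -- ★ `U11Unitary.IsUnitaryGK` ∕ `IsUnitarizableGK`, `isUnitarizableGK_principalSeries_iff`; brings ★ `U11PS` (`P(s, λ)`, `casimir`) and ★ `upqCasimirOp` (`UpqCasimirTensor`)
import HarnessLib

/-!
# K2·E1 — `K2E1CasimirRealOnUnitarizable` (5Res campaign, (d) ARCH-UNITARITY FILE 1): A SYMMETRIC OPERATOR FOR A POSITIVE HERMITIAN FORM HAS REAL EIGENVALUES; THE CASIMIR OF `U(p,q)`
# IS SYMMETRIC FOR EVERY INVARIANT FORM; HENCE THE CASIMIR SCALAR OF A UNITARIZABLE `(𝔤, K)`-MODULE OF `U(1,1)` — IN PARTICULAR THE PARAMETER `λ` OF A UNITARIZABLE `P(s, λ)` — IS REAL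

Track B ∕ K2-LIT, crux h413 = `stmt-HodgeConjecture-24833`, route of record `HCCMUnconditional`; cell `hodgecm-mathlib`, squad K2, ENGINE E1.  THEOREMS ONLY (no `def`, no `instance`, no
notation, no named-fact hypothesis, no `sorry`; default heartbeats); lane `--kind proof --supports stmt-HodgeConjecture-24833 --as helper` (count-neutral).  Road-independent, letter-free.

WHY (K2E4-p23 (g2)'s 5Res census 2026-09-04T10:16:55Z, item (2)(ii) and (3)(d)): finiteness of the residual spectrum per `K`-type needs NO Hecke `L`-function, only a soft pole COUNT —
Maass–Selberg puts the poles of `E(χ, ·)` on the real segment with `L²` residues generating a UNITARY `Π`, and at a complex place `w` with archimedean twist `t_w ≠ 0` the archimedean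
component of `Π` is a subquotient of a principal series of `U(1,1)(ℝ)` whose Casimir scalar is NOT real ⇒ not unitarizable ⇒ no residual pole.  THIS FILE is the algebraic heart of that step:
«Casimir symmetric for an invariant positive Hermitian form ⇒ its eigenvalues are real», packaged in the tree's `U(1,1)` currency.

THE MATHEMATICS [Bump1997, Thm. 2.6.3 (i) (p. 217); BorelWallach2000, 0 §2.5, II §1.3 (1)–(2); Knapp1986, Prop. 8.5 ∕ (8.21)].  For a sesquilinear form `B` (Mathlib convention:
conjugate-linear in the first variable) and an operator `Ω` symmetric for it, `B(Ωx, y) = B(x, Ωy)`, an eigenvector `Ωv = μv` with `B(v, v) ≠ 0` gives `conj(μ)·B(v,v) = B(Ωv, v) =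
B(v, Ωv) = μ·B(v,v)`, so `conj μ = μ` (§1; this is Mathlib's `LinearMap.IsSymmetric.conj_eigenvalue_eq_self` read WITHOUT an `InnerProductSpace` instance — the tree's `(𝔤, K)`-modules
carry a bare form `V →ₗ⋆[ℂ] V →ₗ[ℂ] ℂ`, ★ `U11Unitary.IsUnitaryGK`, so the eight-line sesquilinear reading is proved here rather than routed through a norm structure).  If every
`ρ𝔤(Y)`, `Y ∈ 𝔲(p,q)` (a REAL Lie algebra), is skew for `B`, then every `ρ𝔤(Y)²` is symmetric, hence so is the Casimir `C = Σ_s ρ𝔤(x_s)² − Σ_a ρ𝔤(w_a)²` (★ `upqCasimirOp_eq`, II §1.3 (2))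
(§2); a unitary structure ★ `IsUnitaryGK σK σ𝔤 B` on a `(𝔤, K)`-module of `U(1,1)` has `B` positive definite and `σ𝔤` skew, so a Casimir eigenvalue on a nonzero vector is real (§3);
for the principal series `P(s, λ)` of ★ `U11PS` the Casimir IS the scalar `λ` (★ `U11PS.casimir`), so a unitarizable `P(s, λ)` has `λ ∈ ℝ` — Bump's Thm. 2.6.3 (i) at `U(1,1)`, here
re-derived from §3 AND cited from ★ `isUnitarizableGK_principalSeries_iff` (§3, both roads; the campaign form is the contrapositive `Im λ ≠ 0 ⇒ ¬ unitarizable`).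

* §1 (abstract) **`conj_eq_self_of_symm_of_apply_eq_smul`**, **`im_eq_zero_of_symm_of_apply_eq_smul`**; `symm_mul_of_skew_of_skew`, `symm_mul_self_of_skew`, `symm_sum`, `symm_sub`.
* §2 (`U(α, β)`, every `(𝔤, K)`-module datum `ρ𝔤`) **`upqCasimirOp_symm`** and **`im_eq_zero_of_upqCasimirOp_apply_eq_smul`** (skewness of `ρ𝔤` + `0 < Re B(v,v)` + `C v = μ v` ⇒ `Im μ = 0`).
* §3 (`U(1,1)`) **`im_eq_zero_of_isUnitarizableGK`** (★ `IsUnitarizableGK σK σ𝔤`, `v ≠ 0`, `C v = μ v` ⇒ `Im μ = 0`); **`im_eq_zero_of_isUnitarizableGK_principalSeries`** (via §3 + ★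
  `U11PS.casimir`), `im_eq_zero_of_isUnitarizableGK_principalSeries'` (via ★ `isUnitarizableGK_principalSeries_iff`), and the campaign form **`not_isUnitarizableGK_principalSeries_of_im_ne_zero`**.
NOT HERE (honest scope; → FILE 2 of (d), K2E4-p23's dictionary): the identification of the archimedean component of the automorphic `I(χ_w, z)` on `U(1,1)(ℝ)` with ★ `P(s, λ(z, t_w))` and
the polynomial `λ(z, t_w)` with `Im λ ≠ 0 ⇔ t_w ≠ 0 ∧ z ≠ ½`; Hilbert-space unitary representations (the tree's unitarity is a property of the `(𝔤, K)`-module, BW 0 §2.5); `U(2,1)`.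
HONEST LABEL: HC_CM is proved only modulo the 7 printed citations (2 remaining named inputs: hLiu418 = `stmt-HodgeConjecture-24832`, h413 = `stmt-HodgeConjecture-24833`) until rung 0
closes; this file asserts no named fact, closes no socket and crosses no ceiling by itself; count-neutral.

## References
* [Bump1997] D. Bump, *Automorphic Forms and Representations*, Cambridge Stud. Adv. Math. 55 (1997), §2.6: eq. (6.6), Thm. 2.6.3 (i) (p. 217), Thm. 2.6.7 (p. 230).
* [BorelWallach2000] A. Borel, N. Wallach, *Continuous cohomology, discrete subgroups, and representations of reductive groups*, 2nd ed. (2000), 0 §2.5 (unitary `(𝔤, K)`-modules), II §1.3 (1)–(2)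
  (the Casimir element).
* [Knapp1986] A. W. Knapp, *Representation Theory of Semisimple Groups: An Overview Based on Examples* (1986), Prop. 8.5 and (8.21) (the Casimir acts by a real scalar on unitary irreducibles
  with infinitesimal character).
-/

set_option autoImplicit false
-- the mandated namespace repeats `HodgeConjecture.HodgeConjecture`, as in every `Theorems/*.lean` of this sub-problem
set_option linter.dupNamespace false

noncomputable section

open scoped Matrix ComplexConjugate

namespace Summit.HodgeConjecture.HodgeConjecture.Cruxes.H413.K2E1CasimirRealOnUnitarizable

open Literature.Algebra.Lie Literature.Algebra.Lie.ChevalleyEilenberg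
open Literature.NumberTheory.Automorphic
open Literature.RepresentationTheory.KonnoKonno2007 Literature.RepresentationTheory.KonnoKonno2007.RealDualPair
open Literature.RepresentationTheory.KonnoKonno2007.RealDualPair.UForm
open Literature.RepresentationTheory.BorelWallach2000 Literature.RepresentationTheory.BorelWallach2000.U11HolDS
open Literature.RepresentationTheory.BorelWallach2000.U11Unitary

-- Mathlib idiom (as in Mathlib's `Algebra/Lie/OfAssociative`, every ★ `Upq*` ∕ `U11*` Literature file and the 212 ★ `K2E1b*` Theorems files): the commutator
-- bracket on `Module.End ℂ V`, needed to even STATE `ρ𝔤 : 𝔤 →ₗ⁅ℝ⁆ Module.End ℂ V` (the argument type of ★ `upqCasimirOp`); it overrides nothing.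
attribute [local instance 100] LieRing.ofAssociativeRing

/-! ## §1 A symmetric operator for a sesquilinear form has real eigenvalues on non-isotropic eigenvectors -/

section Abstract

variable {V : Type*} [AddCommGroup V] [Module ℂ V] {B : V →ₗ⋆[ℂ] V →ₗ[ℂ] ℂ}

/-- **`conj μ = μ` for an eigenvalue of a `B`-symmetric operator on a non-isotropic eigenvector**: `B(Ωx, y) = B(x, Ωy)`, `Ωv = μ·v`, `B(v, v) ≠ 0` give `conj(μ)·B(v,v) = μ·B(v,v)`
(`B` is conjugate-linear in the first and linear in the second variable).  Mathlib's `LinearMap.IsSymmetric.conj_eigenvalue_eq_self` read on a bare sesquilinear form.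
[cite: Bump1997, Thm. 2.6.3 (i) (p. 217)] [cite: Knapp1986, Prop. 8.5] -/
theorem conj_eq_self_of_symm_of_apply_eq_smul {Ω : Module.End ℂ V} (hΩ : ∀ x y : V, B (Ω x) y = B x (Ω y)) {v : V} (hv : B v v ≠ 0)
    {μ : ℂ} (h : Ω v = μ • v) : starRingEnd ℂ μ = μ := by
  have h1 : B (Ω v) v = starRingEnd ℂ μ * B v v := by rw [h, LinearMap.map_smulₛₗ₂, smul_eq_mul]
  have h2 : B v (Ω v) = μ * B v v := by rw [h, map_smul, smul_eq_mul]
  exact mul_right_cancel₀ hv (h1.symm.trans ((hΩ v v).trans h2))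

/-- **`Im μ = 0`** for an eigenvalue of a `B`-symmetric operator on a non-isotropic eigenvector (§1 `conj_eq_self_…` and `conj μ = μ ↔ Im μ = 0`). [cite: Bump1997, Thm. 2.6.3 (i) (p. 217)] -/
theorem im_eq_zero_of_symm_of_apply_eq_smul {Ω : Module.End ℂ V} (hΩ : ∀ x y : V, B (Ω x) y = B x (Ω y)) {v : V} (hv : B v v ≠ 0)
    {μ : ℂ} (h : Ω v = μ • v) : μ.im = 0 :=
  Complex.conj_eq_iff_im.1 (conj_eq_self_of_symm_of_apply_eq_smul hΩ hv h)

/-- The product of two `B`-SKEW operators taken in reverse order is adjoint: `B((Y Z)x, y) = B(x, (Z Y)y)`. [cite: Bump1997, eq. (6.6) (p. 217)] -/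
theorem apply_mul_of_skew_of_skew {Y Z : Module.End ℂ V} (hY : ∀ x y : V, B (Y x) y = -B x (Y y)) (hZ : ∀ x y : V, B (Z x) y = -B x (Z y)) (x y : V) :
    B ((Y * Z) x) y = B x ((Z * Y) y) := by
  rw [Module.End.mul_apply, Module.End.mul_apply, hY, hZ, neg_neg]

/-- **The square of a `B`-skew operator is `B`-symmetric**: `B(Y²x, y) = −B(Yx, Yy) = B(x, Y²y)`. [cite: Bump1997, eq. (6.6) (p. 217)] [cite: BorelWallach2000, 0 §2.5] -/
theorem symm_mul_self_of_skew {Y : Module.End ℂ V} (hY : ∀ x y : V, B (Y x) y = -B x (Y y)) (x y : V) :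
    B ((Y * Y) x) y = B x ((Y * Y) y) :=
  apply_mul_of_skew_of_skew hY hY x y

/-- A finite sum of `B`-symmetric operators is `B`-symmetric. [folklore] -/
theorem symm_sum {ι : Type*} (s : Finset ι) {T : ι → Module.End ℂ V} (hT : ∀ i ∈ s, ∀ x y : V, B (T i x) y = B x (T i y)) (x y : V) :
    B ((∑ i ∈ s, T i) x) y = B x ((∑ i ∈ s, T i) y) := by
  classical
  induction s using Finset.induction_on with
  | empty => simp
  | insert i s hi ih =>
    rw [Finset.sum_insert hi, LinearMap.add_apply, LinearMap.add_apply, map_add, LinearMap.add_apply, map_add,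
      hT i (Finset.mem_insert_self i s) x y, ih fun j hj => hT j (Finset.mem_insert_of_mem hj)]

/-- The difference of two `B`-symmetric operators is `B`-symmetric. [folklore] -/
theorem symm_sub {S T : Module.End ℂ V} (hS : ∀ x y : V, B (S x) y = B x (S y)) (hT : ∀ x y : V, B (T x) y = B x (T y)) (x y : V) :
    B ((S - T) x) y = B x ((S - T) y) := by
  rw [LinearMap.sub_apply, LinearMap.sub_apply, map_sub, LinearMap.sub_apply, map_sub, hS, hT]

end Abstract

/-! ## §2 `U(α, β)`: the Casimir `C = Σ_s ρ𝔤(x_s)² − Σ_a ρ𝔤(w_a)²` is symmetric for every form making `ρ𝔤` skew; its eigenvalues on positive vectors are real -/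

section Upq

variable {α β : Type*} [Fintype α] [DecidableEq α] [Fintype β] [DecidableEq β]
  {V : Type*} [AddCommGroup V] [Module ℂ V] {B : V →ₗ⋆[ℂ] V →ₗ[ℂ] ℂ}
  (ρ𝔤 : (uFormGroup α β).lie →ₗ⁅ℝ⁆ Module.End ℂ V)

/-- **THE CASIMIR OF `U(α, β)` IS `B`-SYMMETRIC WHENEVER `𝔲(α, β)` ACTS BY `B`-SKEW OPERATORS** (every `(𝔤, K)`-module datum `ρ𝔤`, every sesquilinear `B`): by ★ `upqCasimirOp_eq`,
`C = Σ_s ρ𝔤(x_s)·ρ𝔤(x_s) − Σ_a ρ𝔤(w_a)·ρ𝔤(w_a)` with `x_s, w_a` in the REAL Lie algebra, and squares of skew operators are symmetric (§1). [cite: BorelWallach2000, II §1.3 (2), 0 §2.5]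
[cite: Bump1997, eq. (6.6) (p. 217)] -/
theorem upqCasimirOp_symm (hskew : ∀ (Y : (uFormGroup α β).lie) (x y : V), B (ρ𝔤 Y x) y = -B x (ρ𝔤 Y y)) (x y : V) :
    B (upqCasimirOp ρ𝔤 x) y = B x (upqCasimirOp ρ𝔤 y) := by
  rw [upqCasimirOp_eq]
  exact symm_sub (symm_sum _ fun s _ => symm_mul_self_of_skew (hskew (upqPBasis s)))
    (symm_sum _ fun a _ => symm_mul_self_of_skew (hskew (upqKVec α β a))) x y

/-- **A CASIMIR EIGENVALUE ON A `B`-POSITIVE VECTOR IS REAL** (`U(α, β)`, every `(𝔤, K)`-module datum): if `𝔲(α, β)` acts by `B`-skew operators, `0 < Re B(v, v)` and `C v = μ·v`, then `Im μ = 0`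
(§2 `upqCasimirOp_symm` + §1). [cite: Knapp1986, Prop. 8.5] [cite: Bump1997, Thm. 2.6.3 (i) (p. 217)] [cite: BorelWallach2000, 0 §2.5] -/
theorem im_eq_zero_of_upqCasimirOp_apply_eq_smul (hskew : ∀ (Y : (uFormGroup α β).lie) (x y : V), B (ρ𝔤 Y x) y = -B x (ρ𝔤 Y y))
    {v : V} (hpos : 0 < (B v v).re) {μ : ℂ} (h : upqCasimirOp ρ𝔤 v = μ • v) : μ.im = 0 :=
  im_eq_zero_of_symm_of_apply_eq_smul (upqCasimirOp_symm ρ𝔤 hskew) (fun h0 => by rw [h0, Complex.zero_re] at hpos; exact lt_irrefl _ hpos) h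

end Upq

/-! ## §3 `U(1,1)`: unitarizable `(𝔤, K)`-modules have real Casimir scalars; the parameter `λ` of a unitarizable `P(s, λ)` is real -/

section U11

variable {V : Type*} [AddCommGroup V] [Module ℂ V]
  {σK : Representation ℂ G11.maximalCompact V} {σ𝔤 : G11.lie →ₗ⁅ℝ⁆ Module.End ℂ V}

/-- **UNDER A UNITARY STRUCTURE A CASIMIR EIGENVALUE IS REAL** (`U(1,1)`, ★ `IsUnitaryGK σK σ𝔤 B`): `v ≠ 0`, `C v = μ·v` ⇒ `Im μ = 0` (`B` positive definite, `σ𝔤` skew, §2).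
[cite: Bump1997, Thm. 2.6.3 (i) (p. 217)] [cite: BorelWallach2000, 0 §2.5] -/
theorem im_eq_zero_of_isUnitaryGK {B : V →ₗ⋆[ℂ] V →ₗ[ℂ] ℂ} (hB : IsUnitaryGK σK σ𝔤 B) {v : V} (hv : v ≠ 0) {μ : ℂ}
    (h : upqCasimirOp σ𝔤 v = μ • v) : μ.im = 0 :=
  im_eq_zero_of_upqCasimirOp_apply_eq_smul σ𝔤 hB.skew (hB.pos v hv) h

/-- **A UNITARIZABLE `(𝔤, K)`-MODULE OF `U(1,1)` HAS REAL CASIMIR EIGENVALUES** (★ `IsUnitarizableGK σK σ𝔤`): `v ≠ 0`, `C v = μ·v` ⇒ `Im μ = 0`.  In particular a module on which the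
Casimir acts by a non-real scalar is NOT unitarizable. [cite: Bump1997, Thm. 2.6.3 (i) (p. 217)] [cite: Knapp1986, Prop. 8.5] -/
theorem im_eq_zero_of_isUnitarizableGK (hU : IsUnitarizableGK σK σ𝔤) {v : V} (hv : v ≠ 0) {μ : ℂ} (h : upqCasimirOp σ𝔤 v = μ • v) : μ.im = 0 := by
  obtain ⟨B, hB⟩ := hU.out
  exact im_eq_zero_of_isUnitaryGK hB hv h

/-- The campaign's contrapositive: **a `(𝔤, K)`-module of `U(1,1)` on which the Casimir has a NON-REAL eigenvalue (on some `v ≠ 0`) is not unitarizable**. [cite: Bump1997, Thm. 2.6.3 (i) (p. 217)] -/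
theorem not_isUnitarizableGK_of_im_ne_zero {v : V} (hv : v ≠ 0) {μ : ℂ} (h : upqCasimirOp σ𝔤 v = μ • v) (hμ : μ.im ≠ 0) : ¬ IsUnitarizableGK σK σ𝔤 :=
  fun hU => hμ (im_eq_zero_of_isUnitarizableGK hU hv h)

/-- **THE PARAMETER `λ` OF A UNITARIZABLE PRINCIPAL SERIES `P(s, λ)` OF `U(1,1)` IS REAL** — via §3 and ★ `U11PS.casimir` (the Casimir of `P(s, λ)` IS `λ`; test vector `v_0 ≠ 0`).
[cite: Bump1997, Thm. 2.6.3 (i) (p. 217)] -/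
theorem im_eq_zero_of_isUnitarizableGK_principalSeries (s : ℤ) {lam : ℂ} (h : IsUnitarizableGK (U11PS.kAct s) (U11PS.lieAct s lam)) : lam.im = 0 :=
  im_eq_zero_of_isUnitarizableGK h (U11PS.v_ne_zero 0) (U11PS.casimir s lam (U11PS.v 0))

/-- The same, read off the tree's unitary dual: ★ `isUnitarizableGK_principalSeries_iff` gives `λ = t ∈ ℝ` outright. [cite: Bump1997, Thm. 2.6.3 (i), Thm. 2.6.7 (ii)–(iii)] -/
theorem im_eq_zero_of_isUnitarizableGK_principalSeries' (s : ℤ) {lam : ℂ} (h : IsUnitarizableGK (U11PS.kAct s) (U11PS.lieAct s lam)) : lam.im = 0 := by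
  obtain ⟨t, rfl, -⟩ := (isUnitarizableGK_principalSeries_iff s lam).1 h
  exact Complex.ofReal_im t

/-- **ARCH-UNITARITY, THE CAMPAIGN FORM: `Im λ ≠ 0 ⇒ P(s, λ)` IS NOT UNITARIZABLE** (so an irreducible unitary `Π` whose archimedean component at a complex place is `P(s, λ)` with `Im λ ≠ 0`
does not exist — the pole-killing step of K2E4-p23 (g2)'s 5Res census (2)(ii)). [cite: Bump1997, Thm. 2.6.3 (i) (p. 217), Thm. 2.6.7] -/
theorem not_isUnitarizableGK_principalSeries_of_im_ne_zero (s : ℤ) {lam : ℂ} (hlam : lam.im ≠ 0) : ¬ IsUnitarizableGK (U11PS.kAct s) (U11PS.lieAct s lam) :=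
  fun h => hlam (im_eq_zero_of_isUnitarizableGK_principalSeries s h)

end U11

end Summit.HodgeConjecture.HodgeConjecture.Cruxes.H413.K2E1CasimirRealOnUnitarizable

end
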